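import Summits.NavierStokesRegularity.NavierStokesRegularity.Theses.BernoulliDeceleration
import Literature.Analysis.FluidPDE.SereginSverakPressureProofs
import HarnessLib

/-!
# Line `rate_dichotomy` for the crux `DeceleratingSetHeadBound` (stmt-NavierStokesRegularity-3032)

Strategist line = the typed BC2-redirect decomposition of the RESTATED deciding crux of route
`BernoulliDeceleration`. The three stubs are VERBATIM the statements of the three children of the
prepared split (`Cruxes/DeceleratingSetHeadBound/SPLIT-READY.md`, `children.json`), so a proof of a
stub landed `--supports stmt-NavierStokesRegularity-3032` is a proof of the corresponding child item
once the split is applied: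

* `stub_headTypeIOnDeceleratingSet`      = child `HeadTypeIOnDeceleratingSet` (crux, rank 2: the
  Type-II half — the head obeys the Type-I rate `(T - t) Π̃ ≤ C` on the decelerating set `D`);
* `stub_deceleratingTypeIHeadRegularity` = child `DeceleratingTypeIHeadRegularity` (crux, rank 3:
  the Type-I half — a Type-I head bound on `D` excludes singular points on the final slice;
  Seregin–Šverák 2002 at the critical majorant);
* `stub_boundedFlowHeadCeiling`          = child `BoundedFlowHeadCeiling` (support: bounded velocity
  on every `(δ, T) × ℝ³` ⟹ head bounded above on `[0, T) × ℝ³`).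

`DeceleratingSetHeadBound_of` is the ASSEMBLY, kernel-checked and sorry-free: C1 feeds C2; backward
boundedness at every point of the final slice is globalised to `(δ, T) × ℝ³` by the tree's
far-field ε-regularity bound `SereginSverak2002.farField_bound` (Lemarié-Rieusset 2016 Thm. 14.4)
and the compactness near-field bound `SereginSverak2002.nearField_bound` (the ESS 2003 (3.5) ⇒ (3.6)
passage); C3 converts the velocity bound into the head ceiling, restricted to `D`. Its conclusion
is literally the route decl
`Summit.NavierStokesRegularity.NavierStokesRegularity.Theses.BernoulliDeceleration.DeceleratingSetHeadBound`.
-/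

set_option linter.dupNamespace false

namespace Summit.NavierStokesRegularity.NavierStokesRegularity.Cruxes.DeceleratingSetHeadBound.RateDichotomy

open Set Metric Function
open Literature.Analysis.FluidPDE
open Summit.NavierStokesRegularity.NavierStokesRegularity.Theses.BernoulliDeceleration

/-- STUB 1 = child `HeadTypeIOnDeceleratingSet` (crux, rank 2): Type-I rate of the head on the
decelerating set. [line rate_dichotomy; open — the Type-II exclusion for the head] -/
theorem stub_headTypeIOnDeceleratingSet :
    ∀ (ν T : ℝ), 0 < ν → 0 < T → ∀ (u : ℝ → EuclideanSpace ℝ (Fin 3) → EuclideanSpace ℝ (Fin 3)) (p : ℝ → EuclideanSpace ℝ (Fin 3) → ℝ), Literature.Analysis.FluidPDE.IsClassicalNSSolutionOn (Set.Ico 0 T) ν 0 u p → Literature.Analysis.FluidPDE.IsLerayHopfOn T ν 0 (u 0) u → Literature.Analysis.FluidPDE.HasRapidSpatialDecay (u 0) → ∃ C : ℝ, ∀ t ∈ Set.Ico 0 T, ∀ x, Literature.Analysis.FluidPDE.timeDerivWithin (Set.Ico 0 T) (fun s z => ‖u s z‖ ^ 2) t x ≤ -(2 * ν * ‖Literature.Analysis.FluidPDE.curl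 (u t) x‖ ^ 2) → (T - t) * (‖u t x‖ ^ 2 / 2 + Literature.Analysis.FluidPDE.normalisedPressure (u t) x) ≤ C := by
  sorry

/-- STUB 2 = child `DeceleratingTypeIHeadRegularity` (crux, rank 3): a Type-I-rate head bound on
the decelerating set rules out singular points on the final slice (backward boundedness at every
`(T, x₀)`). [line rate_dichotomy; open — one-sided Type-I Liouville; plan: HeadPeaksDecelerate +
locally-Type-I zoom + ¬LocalTypeISingularityExists, cf. `Lines/birth_DeceleratingTypeIHeadRegularity.lean`] -/
theorem stub_deceleratingTypeIHeadRegularity :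
    ∀ (ν T : ℝ), 0 < ν → 0 < T → ∀ (u : ℝ → EuclideanSpace ℝ (Fin 3) → EuclideanSpace ℝ (Fin 3)) (p : ℝ → EuclideanSpace ℝ (Fin 3) → ℝ), Literature.Analysis.FluidPDE.IsClassicalNSSolutionOn (Set.Ico 0 T) ν 0 u p → Literature.Analysis.FluidPDE.IsLerayHopfOn T ν 0 (u 0) u → Literature.Analysis.FluidPDE.HasRapidSpatialDecay (u 0) → (∃ C : ℝ, ∀ t ∈ Set.Ico 0 T, ∀ x, Literature.Analysis.FluidPDE.timeDerivWithin (Set.Ico 0 T) (fun s z => ‖u s z‖ ^ 2) t x ≤ -(2 * ν * ‖Literature.Analysis.FluidPDE.curl (u t) x‖ ^ 2) → (T - t) * (‖u t x‖ ^ 2 / 2 + Literature.Analysis.FluidPDE.normalisedPressure (u t) x) ≤ C) → ∀ x₀ : EuclideanSpace ℝ (Fin 3), ∃ r > 0, ∃ M : ℝ, ∀ t ∈ Set.Ioo (T - r ^ 2) T, ∀ x ∈ Metric.ball x₀ r, ‖u t x‖ ≤ M := by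
  sorry

/-- STUB 3 = child `BoundedFlowHeadCeiling` (support): a velocity bounded on every `(δ, T) × ℝ³`
has its head bounded above on `[0, T) × ℝ³`. [line rate_dichotomy; routine: local strong theory
near `t = 0`, gradient bounds for bounded solutions, `abs_normalisedPressure_le`] -/
theorem stub_boundedFlowHeadCeiling :
    ∀ (ν T : ℝ), 0 < ν → 0 < T → ∀ (u : ℝ → EuclideanSpace ℝ (Fin 3) → EuclideanSpace ℝ (Fin 3)) (p : ℝ → EuclideanSpace ℝ (Fin 3) → ℝ), Literature.Analysis.FluidPDE.IsClassicalNSSolutionOn (Set.Ico 0 T) ν 0 u p → Literature.Analysis.FluidPDE.IsLerayHopfOn T ν 0 (u 0) u → Literature.Analysis.FluidPDE.HasRapidSpatialDecay (u 0) → (∀ δ ∈ Set.Ioo 0 T, ∃ M : ℝ, ∀ t ∈ Set.Ioo δ T, ∀ x, ‖u t x‖ ≤ M) → ∃ K : ℝ, ∀ t ∈ Set.Ico 0 T, ∀ x, ‖u t x‖ ^ 2 / 2 + Literature.Analysis.FluidPDE.normalisedPressure (u t) x ≤ K := by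
  sorry

/-- **Assembly of the line** (= the glue of the split): the three stubs imply the crux, BY NAME.
Real proof: far-field ε-regularity + compactness near field globalise C2's pointwise conclusion;
C3 gives the head ceiling; restrict to `D`. -/
theorem DeceleratingSetHeadBound_of :
    (∀ (ν T : ℝ), 0 < ν → 0 < T → ∀ (u : ℝ → EuclideanSpace ℝ (Fin 3) → EuclideanSpace ℝ (Fin 3)) (p : ℝ → EuclideanSpace ℝ (Fin 3) → ℝ), Literature.Analysis.FluidPDE.IsClassicalNSSolutionOn (Set.Ico 0 T) ν 0 u p → Literature.Analysis.FluidPDE.IsLerayHopfOn T ν 0 (u 0) u → Literature.Analysis.FluidPDE.HasRapidSpatialDecay (u 0) → ∃ C : ℝ, ∀ t ∈ Set.Ico 0 T, ∀ x, Literature.Analysis.FluidPDE.timeDerivWithin (Set.Ico 0 T) (fun s z => ‖u s z‖ ^ 2) t x ≤ -(2 * ν * ‖Literature.Analysis.FluidPDE.curl (u t) x‖ ^ 2) → (T - t) * (‖u t x‖ ^ 2 / 2 + Literature.Analysis.FluidPDE.normalisedPressure (u t) x) ≤ C) →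
    (∀ (ν T : ℝ), 0 < ν → 0 < T → ∀ (u : ℝ → EuclideanSpace ℝ (Fin 3) → EuclideanSpace ℝ (Fin 3)) (p : ℝ → EuclideanSpace ℝ (Fin 3) → ℝ), Literature.Analysis.FluidPDE.IsClassicalNSSolutionOn (Set.Ico 0 T) ν 0 u p → Literature.Analysis.FluidPDE.IsLerayHopfOn T ν 0 (u 0) u → Literature.Analysis.FluidPDE.HasRapidSpatialDecay (u 0) → (∃ C : ℝ, ∀ t ∈ Set.Ico 0 T, ∀ x, Literature.Analysis.FluidPDE.timeDerivWithin (Set.Ico 0 T) (fun s z => ‖u s z‖ ^ 2) t x ≤ -(2 * ν * ‖Literature.Analysis.FluidPDE.curl (u t) x‖ ^ 2) → (T - t) * (‖u t x‖ ^ 2 / 2 + Literature.Analysis.FluidPDE.normalisedPressure (u t) x) ≤ C) → ∀ x₀ : EuclideanSpace ℝ (Fin 3), ∃ r > 0, ∃ M : ℝ, ∀ t ∈ Set.Ioo (T - r ^ 2) T, ∀ x ∈ Metric.ball x₀ r, ‖u t x‖ ≤ M) →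
    (∀ (ν T : ℝ), 0 < ν → 0 < T → ∀ (u : ℝ → EuclideanSpace ℝ (Fin 3) → EuclideanSpace ℝ (Fin 3)) (p : ℝ → EuclideanSpace ℝ (Fin 3) → ℝ), Literature.Analysis.FluidPDE.IsClassicalNSSolutionOn (Set.Ico 0 T) ν 0 u p → Literature.Analysis.FluidPDE.IsLerayHopfOn T ν 0 (u 0) u → Literature.Analysis.FluidPDE.HasRapidSpatialDecay (u 0) → (∀ δ ∈ Set.Ioo 0 T, ∃ M : ℝ, ∀ t ∈ Set.Ioo δ T, ∀ x, ‖u t x‖ ≤ M) → ∃ K : ℝ, ∀ t ∈ Set.Ico 0 T, ∀ x, ‖u t x‖ ^ 2 / 2 + Literature.Analysis.FluidPDE.normalisedPressure (u t) x ≤ K) →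
      DeceleratingSetHeadBound := by
  intro h₁ h₂ h₃ ν T hν hT u p hsol hLH hdec
  -- C1: the Type-I rate of the head on the decelerating set
  obtain ⟨C, hC⟩ := h₁ ν T hν hT u p hsol hLH hdec
  -- C2: no singular point on the final slice `t = T`
  have htop : ∀ x₀ : EuclideanSpace ℝ (Fin 3), IsBackwardBoundedAt u T x₀ := fun x₀ =>
    h₂ ν T hν hT u p hsol hLH hdec ⟨C, hC⟩ x₀
  -- globalisation to `(δ, T) × ℝ³`: far field by ε-regularity, near field by compactness
  have hbdd : ∀ δ ∈ Set.Ioo 0 T, ∃ M : ℝ, ∀ t ∈ Set.Ioo δ T, ∀ x, ‖u t x‖ ≤ M := by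
    intro δ hδ
    obtain ⟨R, M₁, hfar⟩ := SereginSverak2002.farField_bound hν hT hsol hLH hδ.1
    obtain ⟨M₂, hnear⟩ := SereginSverak2002.nearField_bound hT
      (SereginSverak2002.continuousOn_uncurry hsol) htop hδ.1 R
    refine ⟨max M₁ M₂, fun t ht x => ?_⟩
    by_cases hx : ‖x‖ ≤ R
    · exact (hnear (t, x) ⟨⟨ht.1.le, ht.2.le⟩, mem_closedBall_zero_iff.2 hx⟩ ht.2).trans
        (le_max_right _ _)
    · exact (hfar t ht x (not_le.1 hx)).trans (le_max_left _ _)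
  -- C3: the bounded velocity has a head ceiling on `[0, T) × ℝ³`; restrict it to `D`
  obtain ⟨K, hK⟩ := h₃ ν T hν hT u p hsol hLH hdec hbdd
  exact ⟨K, fun t ht x _ => hK t ht x⟩

/-- The crux from the registered stubs (what closes stmt-3032 once the three stubs are proved). -/
theorem DeceleratingSetHeadBound_of_stubs : DeceleratingSetHeadBound :=
  DeceleratingSetHeadBound_of stub_headTypeIOnDeceleratingSet stub_deceleratingTypeIHeadRegularity
    stub_boundedFlowHeadCeiling

end Summit.NavierStokesRegularity.NavierStokesRegularity.Cruxes.DeceleratingSetHeadBound.RateDichotomy
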